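import Mathlib
import Literature.NumberTheory.LFunctions.VinogradovZetaSumLemmas
import Literature.NumberTheory.Sieve.LiouvillePolynomialValuesRecurrentLinear
import Literature.NumberTheory.Sieve.LiouvillePolynomialValuesWeylDifferencing
import HarnessLib

/-!
# Weyl's exponential sum estimate for the top coefficient (Green–Tao 2012, Lemma 4.4)

Support file (everything PROVED; no definitions, no named facts) towards the named fact
`Literature.NumberTheory.Sieve.teravainen2024_cor_2_1` (J. Teräväinen, *On the Liouville function
at polynomial arguments*, Amer. J. Math. 146 (2024) = arXiv:2010.07924, Corollary 2.1 ⊂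
Theorem 2.6, proved in §5). The minor-arc case of Proposition 5.4 there rests on Lemma 5.6, whose
proof invokes "standard estimates for Weyl sums (see [Green–Tao, *The quantitative behaviour of
polynomial orbits on nilmanifolds*, Ann. of Math. 175 (2012)])". The core of those estimates is

> **[GT12, Lemma 4.4]** (Weyl's exponential sum estimate). Suppose that `g : ℤ → ℝ` is a
> polynomial of degree `d` with leading coefficient `α_d` and that `|𝔼_{n∈[N]} e(g(n))| ≥ δ` for
> some `0 < δ < 1/2`. Then there is `k ∈ ℤ`, `|k| ≪ δ^{-O_d(1)}`, such that
> `‖k α_d‖_{ℝ/ℤ} ≪ δ^{-O_d(1)}/N^d`.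
>
> *Proof.* "We proceed by induction on `d`, the result having been established in §3 in the case
> `d = 1` [geometric series]. […] Applying van der Corput's estimate in the form of Corollary 4.2 we
> deduce that there are `≫ δ²N` values of `h ∈ [N]` such that `|𝔼_{n∈[N]} e(g(n+h) - g(n))| ≫ δ²`.
> For each such `h`, `g(n+h) - g(n)` is a polynomial with degree `d - 1` and leading coefficient
> `h d α_d`. Thus by the induction hypothesis there is, for `≫ δ²` values of `h ∈ [N]`, some
> `1 ≤ q_h ≪ δ^{-O_d(1)}` such that `‖h q_h d α_d‖ ≪ δ^{-O_d(1)}/N^{d-1}` […]. Pigeonholing in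
> the `q_h` […] there is `q ≪ δ^{-O_d(1)}` such that `‖h q d α_d‖ ≪ δ^{-O_d(1)}/N^{d-1}` for
> `≫ δ^{O_d(1)} N` values of `h ∈ [N]`. Since `N` is so large, Lemma 3.2 may be applied to conclude
> that there is `q' ≪ δ^{-O_d(1)}` such that `‖qq' α_d‖ ≪ δ^{-O_d(1)}/N^d`."

This file formalizes exactly that induction (`Teravainen2024.weyl_topCoeff`), with the implied
constants kept existential but of the explicit shape `C (8/δ²)^A` (`A ∈ ℕ`, `C ≥ 1` depending
only on `d`), for real polynomials `p ∈ ℝ[X]` of degree `≤ d` and Weyl sums over an arbitrary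
interval of integers `(a, a+L]`; `‖·‖_{ℝ/ℤ}` is the tree's
`Literature.NumberTheory.Sieve.Vinogradov.distInt`. Inputs: the tree's geometric series bound
`Literature.NumberTheory.LFunctions.VinogradovZetaSum.norm_sum_e_mul_le_geomBound` (base case),
the van der Corput dichotomy `Teravainen2024.card_goodShifts_ge_of_norm_sum_e_ge` (GT Cor. 4.2,
`LiouvillePolynomialValuesWeylDifferencing.lean`) and the linear recurrence lemma
`Teravainen2024.exists_denominator_of_recurrent_linear` (GT Lemma 3.2,
`LiouvillePolynomialValuesRecurrentLinear.lean`); the finite-difference algebra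
(`coeff_taylor_eq_sum`, `natDegree_diff_le`, `coeff_diff_eq`: `Δ_h p = p(X+h) - p` has degree
`≤ d` and `X^d`-coefficient `(d+1) h p_{d+1}`) uses Mathlib's `Polynomial.taylor`.

* `Teravainen2024.weyl_topCoeff` — GT Lemma 4.4 as above;
* `Teravainen2024.weyl_topCoeff_step`, `weyl_step_shift`, `weyl_step_K_le`,
  `weyl_step_sideConditions`, `weyl_step_newConstants`, `weyl_step_small` — the induction step and
  its bookkeeping (new constants `E = (6A+d+2)(d+1) + 9A + d + 2`,
  `C' = 192 C³ (96C²)^{d+1} · 4(d+1)`).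

Not here: the descent to the lower coefficients (GT Proposition 4.3) and the polynomial
recurrence lemma (GT Lemma 4.5), the remaining inputs of Teräväinen's Lemma 5.6.

## References
* B. Green, T. Tao, Ann. of Math. 175 (2012), 465–540, §4: Lemma 4.1, Corollary 4.2, Lemma 4.4
  and its proof (arXiv:0709.3562, §4). [GreenTao2012Nilmanifolds]
* J. Teräväinen, Amer. J. Math. 146 (2024), §5.4, Lemma 5.6. [Teravainen2024]
-/

noncomputable section

open Finset

namespace Literature.NumberTheory.Sieve

namespace Teravainen2024

open Polynomial
open Literature.NumberTheory.LFunctions Literature.NumberTheory.Sieve.Vinogradov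

/-! ### Finite differences of real polynomials -/

/-- Coefficients of the Taylor shift `p(X + h)`:
`[X^m] p(X+h) = ∑_j C(j+m, m) p_{j+m} h^j`. [folklore] -/
theorem coeff_taylor_eq_sum (p : ℝ[X]) (h : ℝ) (m : ℕ) :
    (Polynomial.taylor h p).coeff m =
      ∑ j ∈ Finset.range (p.natDegree + 1), ((j + m).choose m : ℝ) * p.coeff (j + m) * h ^ j := by
  rw [Polynomial.taylor_coeff, Polynomial.eval_eq_sum_range' (n := p.natDegree + 1)]
  · refine Finset.sum_congr rfl fun j _ => ?_
    rw [Polynomial.hasseDeriv_coeff]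
  · exact lt_of_le_of_lt (Polynomial.natDegree_hasseDeriv_le p m) (by omega)

/-- The difference `Δ_h p = p(X+h) - p(X)` of a polynomial of degree `≤ d+1` has degree `≤ d`.
[folklore] -/
theorem natDegree_diff_le {p : ℝ[X]} {d : ℕ} (hp : p.natDegree ≤ d + 1) (h : ℝ) :
    (Polynomial.taylor h p - p).natDegree ≤ d := by
  rw [Polynomial.natDegree_le_iff_coeff_eq_zero]
  intro m hm
  have hdm : d + 1 ≤ m := hm
  rw [Polynomial.coeff_sub, coeff_taylor_eq_sum, Finset.sum_eq_single 0]
  · simp only [zero_add, Nat.choose_self, Nat.cast_one, one_mul, pow_zero, mul_one]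
    rcases hdm.eq_or_lt with hmeq | hmlt
    · exact sub_self _
    · rw [Polynomial.coeff_eq_zero_of_natDegree_lt (by omega), sub_zero]
  · intro j _ hj
    rw [Polynomial.coeff_eq_zero_of_natDegree_lt (by omega)]
    simp
  · intro h0
    exact absurd (Finset.mem_range.mpr (Nat.succ_pos _)) h0

/-- The leading behaviour of `Δ_h p`: for `deg p ≤ d+1`,
`[X^d] (p(X+h) - p(X)) = (d+1) h · [X^{d+1}] p`. [folklore] -/
theorem coeff_diff_eq {p : ℝ[X]} {d : ℕ} (hp : p.natDegree ≤ d + 1) (h : ℝ) :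
    (Polynomial.taylor h p - p).coeff d = (d + 1) * h * p.coeff (d + 1) := by
  rw [Polynomial.coeff_sub, coeff_taylor_eq_sum]
  -- extend the range to `natDegree + 3 ≥ 2`; only `j = 0, 1` contribute
  have hext : ∑ j ∈ Finset.range (p.natDegree + 1),
      ((j + d).choose d : ℝ) * p.coeff (j + d) * h ^ j =
        ∑ j ∈ Finset.range (p.natDegree + 3), ((j + d).choose d : ℝ) * p.coeff (j + d) * h ^ j := by
    symm
    rw [Finset.sum_range_succ, Finset.sum_range_succ,
      Polynomial.coeff_eq_zero_of_natDegree_lt (show p.natDegree < p.natDegree + 1 + d by omega),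
      Polynomial.coeff_eq_zero_of_natDegree_lt (show p.natDegree < p.natDegree + 2 + d by omega)]
    ring
  rw [hext, ← Finset.sum_range_add_sum_Ico _ (show 2 ≤ p.natDegree + 3 by omega)]
  have htail : ∑ j ∈ Finset.Ico 2 (p.natDegree + 3),
      ((j + d).choose d : ℝ) * p.coeff (j + d) * h ^ j = 0 := by
    refine Finset.sum_eq_zero fun j hj => ?_
    rw [Finset.mem_Ico] at hj
    rw [Polynomial.coeff_eq_zero_of_natDegree_lt (by omega)]
    simp
  rw [htail, add_zero]
  simp only [Finset.sum_range_succ, Finset.sum_range_zero, zero_add, Nat.choose_self,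
    Nat.cast_one, one_mul, pow_zero, mul_one, pow_one]
  rw [show 1 + d = d + 1 by ring, Nat.choose_succ_self_right]
  push_cast
  ring

/-- Values of `Δ_h p`: `(p(X+h) - p)(x) = p(x + h) - p(x)`. [folklore] -/
theorem eval_diff (p : ℝ[X]) (h x : ℝ) :
    (Polynomial.taylor h p - p).eval x = p.eval (x + h) - p.eval x := by
  rw [Polynomial.eval_sub, Polynomial.taylor_eval]

/-! ### Pigeonholing a family of bounded labels -/

/-- If every element of `G` carries a label in `[1, K]` (`K ≥ 1`), some label is carried by at
least `#G / K` elements. [folklore] -/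
theorem exists_popular_label {ι : Type*} [DecidableEq ι] (G : Finset ι) (lab : ι → ℕ) {K : ℕ}
    (hK : 1 ≤ K) (hlab : ∀ g ∈ G, 1 ≤ lab g ∧ lab g ≤ K) :
    ∃ k : ℕ, 1 ≤ k ∧ k ≤ K ∧ (#G : ℝ) / K ≤ #(G.filter fun g => lab g = k) := by
  classical
  have hne : (Finset.Icc 1 K).Nonempty := ⟨1, Finset.mem_Icc.mpr ⟨le_rfl, hK⟩⟩
  obtain ⟨k, hk, hmax⟩ := Finset.exists_max_image (Finset.Icc 1 K)
    (fun k => #(G.filter fun g => lab g = k)) hne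
  rw [Finset.mem_Icc] at hk
  refine ⟨k, hk.1, hk.2, ?_⟩
  have hsum := Finset.card_eq_sum_card_fiberwise (f := lab) (s := G) (t := Finset.Icc 1 K)
    (fun g hg => Finset.mem_Icc.mpr (hlab g hg))
  have hKpos : (0 : ℝ) < K := by exact_mod_cast hK
  rw [div_le_iff₀ hKpos, hsum]
  push_cast
  calc ∑ j ∈ Finset.Icc 1 K, (#(G.filter fun g => lab g = j) : ℝ)
      ≤ ∑ j ∈ Finset.Icc 1 K, (#(G.filter fun g => lab g = k) : ℝ) :=
        Finset.sum_le_sum fun j hj => by exact_mod_cast hmax j hj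
    _ = #(G.filter fun g => lab g = k) * K := by
        rw [Finset.sum_const, Nat.card_Icc, nsmul_eq_mul]
        push_cast
        ring

/-! ### Weyl's estimate for the top coefficient -/

/-- **The linear case** (`d = 1`): if `‖∑_{a<n≤a+L} e(p(n))‖ ≥ δL` for a polynomial `p` of
degree `≤ 1` then `‖p_1‖_{ℝ/ℤ} ≤ 1/(2δL)` (geometric series; the tree's
`Literature.NumberTheory.LFunctions.VinogradovZetaSum.norm_sum_e_mul_le_geomBound`).
[cite: GreenTao2012Nilmanifolds, Lemma 3.1 (m = 1)] -/
theorem distInt_coeff_one_le_of_norm_sum_e_ge {p : ℝ[X]} (hp : p.natDegree ≤ 1) {δ : ℝ}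
    (hδ : 0 < δ) (a : ℤ) {L : ℕ} (hL : 1 ≤ L)
    (hS : δ * L ≤ ‖∑ n ∈ Finset.Ioc a (a + L), VdC.e (p.eval (n : ℝ))‖) :
    distInt (p.coeff 1) ≤ 1 / (2 * δ * L) := by
  have hLpos : (0 : ℝ) < L := by exact_mod_cast hL
  -- `p(n) = p₀ + p₁ n`
  have hev : ∀ x : ℝ, p.eval x = p.coeff 0 + p.coeff 1 * x := by
    intro x
    rw [Polynomial.eval_eq_sum_range' (n := 2) (by omega)]
    simp [Finset.sum_range_succ]
  have hsum : ∑ n ∈ Finset.Ioc a (a + L), VdC.e (p.eval (n : ℝ)) =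
      VdC.e (p.coeff 0) * ∑ n ∈ Finset.Ioc a (a + L), VdC.e (p.coeff 1 * n) := by
    rw [Finset.mul_sum]
    refine Finset.sum_congr rfl fun n _ => ?_
    rw [hev, VdC.e_add]
  rw [hsum, norm_mul, VdC.norm_e, one_mul] at hS
  have hgeom := VinogradovZetaSum.norm_sum_e_mul_le_geomBound (p.coeff 1) a L
  rcases eq_or_lt_of_le (distInt_nonneg (p.coeff 1)) with h0 | hpos
  · rw [← h0]
    positivity
  · have h1 := (hS.trans hgeom).trans (geomBound_le_inv (L : ℝ) hpos)
    -- `δ L ≤ 1/(2 ‖p₁‖)` ⟹ `‖p₁‖ ≤ 1/(2 δ L)`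
    rw [le_div_iff₀ (by positivity)] at h1
    rw [le_div_iff₀ (by positivity)]
    nlinarith

/-! ### The induction step of Weyl's estimate, in pieces -/

/-- **One good shift.** Given the statement of Weyl's estimate in degree `d` (constants `A, C`)
and a shift `1 ≤ h < L` for which the differenced sum of a degree-`≤ d+1` phase is large,
`‖∑_{a<n≤a+L-h} e(p(n+h) - p(n))‖ ≥ δ²L/8`, the degree-`d` estimate applied to `Δ_h p` (whose
`X^d`-coefficient is `(d+1) h p_{d+1}`) yields `1 ≤ k ≤ C (8u²)^A` (`u = 8/δ²`) with
`‖h · k (d+1) p_{d+1}‖ ≤ C (8u²)^A u^d / L^d`. [cite: GreenTao2012Nilmanifolds, Lemma 4.4 (proof)] -/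
theorem weyl_step_shift {d A : ℕ} {C : ℝ} (hC0 : 0 < C)
    (hIH : ∀ (δ : ℝ) (a : ℤ) (L : ℕ) (p : ℝ[X]), 0 < δ → δ ≤ 1 → p.natDegree ≤ d → 1 ≤ L →
        δ * L ≤ ‖∑ n ∈ Finset.Ioc a (a + L), VdC.e (p.eval (n : ℝ))‖ →
        ∃ k : ℕ, 1 ≤ k ∧ (k : ℝ) ≤ C * (8 / δ ^ 2) ^ A ∧
          distInt (k * p.coeff d) ≤ C * (8 / δ ^ 2) ^ A / (L : ℝ) ^ d)
    {δ : ℝ} (hδ : 0 < δ) (hδ1 : δ ≤ 1) (a : ℤ) {L : ℕ} {p : ℝ[X]} (hp : p.natDegree ≤ d + 1)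
    {h : ℤ} (hh1 : 1 ≤ h) (hhL : h < L)
    (hgood : δ ^ 2 * L / 8 ≤
      ‖∑ n ∈ Finset.Ioc a (a + L - h), VdC.e (p.eval ((n : ℝ) + (h : ℝ)) - p.eval (n : ℝ))‖) :
    ∃ k : ℕ, 1 ≤ k ∧ (k : ℝ) ≤ C * (8 * (8 / δ ^ 2) ^ 2) ^ A ∧
      distInt (h * (k * ((d + 1) * p.coeff (d + 1)))) ≤
        C * (8 * (8 / δ ^ 2) ^ 2) ^ A * (8 / δ ^ 2) ^ d / (L : ℝ) ^ d := by
  have hδ2 : 0 < δ ^ 2 := by positivity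
  set u : ℝ := 8 / δ ^ 2 with hu
  -- the differenced sum as a Weyl sum of `Δ_h p` over `(a, a + L_h]`
  set q : ℝ[X] := Polynomial.taylor (h : ℝ) p - p with hq
  have hqdeg : q.natDegree ≤ d := by rw [hq]; exact natDegree_diff_le hp h
  set Lh : ℕ := (L - h).toNat with hLh
  have hLhZ : (Lh : ℤ) = L - h := Int.toNat_of_nonneg (by omega)
  have hsumq : ∑ n ∈ Finset.Ioc a (a + L - h), VdC.e (p.eval ((n : ℝ) + (h : ℝ)) - p.eval (n : ℝ)) =
      ∑ n ∈ Finset.Ioc a (a + Lh), VdC.e (q.eval (n : ℝ)) := by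
    rw [show a + (Lh : ℤ) = a + L - h by rw [hLhZ]; ring]
    refine Finset.sum_congr rfl fun n _ => ?_
    rw [hq, eval_diff]
  rw [hsumq] at hgood
  have hLhle : (Lh : ℝ) ≤ L := by
    have : (Lh : ℤ) ≤ L := by omega
    exact_mod_cast this
  have hnormle : ‖∑ n ∈ Finset.Ioc a (a + Lh), VdC.e (q.eval (n : ℝ))‖ ≤ Lh := by
    refine (norm_sum_le _ _).trans ?_
    simp [VdC.norm_e]
  have hLhge : δ ^ 2 * L / 8 ≤ Lh := hgood.trans hnormle
  have hLhpos : (0 : ℝ) < Lh := by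
    have hLpos : (0 : ℝ) < L := by
      have : (1 : ℤ) < L := lt_of_le_of_lt hh1 hhL
      have : (1 : ℝ) < L := by exact_mod_cast this
      linarith
    exact lt_of_lt_of_le (by positivity) hLhge
  have hLh1 : 1 ≤ Lh := by exact_mod_cast hLhpos
  set δ' : ℝ := δ ^ 2 / 8 with hδ'
  have hδ'0 : 0 < δ' := by positivity
  have hδ'1 : δ' ≤ 1 := by rw [hδ']; nlinarith
  have hδ'u : 8 / δ' ^ 2 = 8 * u ^ 2 := by
    rw [hδ', hu]
    field_simp
  have hS' : δ' * Lh ≤ ‖∑ n ∈ Finset.Ioc a (a + Lh), VdC.e (q.eval (n : ℝ))‖ := by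
    refine le_trans ?_ hgood
    rw [hδ']
    have := mul_le_mul_of_nonneg_left hLhle hδ2.le
    linarith
  obtain ⟨k, hk1, hkK, hkdist⟩ := hIH δ' a Lh q hδ'0 hδ'1 hqdeg hLh1 hS'
  rw [hδ'u] at hkK hkdist
  refine ⟨k, hk1, hkK, ?_⟩
  have hqc : q.coeff d = (d + 1) * h * p.coeff (d + 1) := by rw [hq]; exact coeff_diff_eq hp h
  rw [hqc] at hkdist
  have e : (k : ℝ) * ((d + 1) * (h : ℝ) * p.coeff (d + 1)) = h * (k * ((d + 1) * p.coeff (d + 1))) := by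
    ring
  rw [e] at hkdist
  refine hkdist.trans ?_
  have hLpos : (0 : ℝ) < L := lt_of_lt_of_le hLhpos hLhle
  rw [div_le_div_iff₀ (by positivity) (by positivity)]
  have hLuLh : (L : ℝ) ≤ u * Lh := by
    rw [hu, div_mul_eq_mul_div, le_div_iff₀ hδ2]
    have := hLhge
    rw [div_le_iff₀ (by norm_num : (0 : ℝ) < 8)] at this
    nlinarith
  have hpow : (L : ℝ) ^ d ≤ (u * Lh) ^ d := pow_le_pow_left₀ hLpos.le hLuLh d
  rw [mul_pow] at hpow
  calc C * (8 * u ^ 2) ^ A * (L : ℝ) ^ d ≤ C * (8 * u ^ 2) ^ A * (u ^ d * (Lh : ℝ) ^ d) :=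
        mul_le_mul_of_nonneg_left hpow (by positivity)
    _ = C * (8 * u ^ 2) ^ A * u ^ d * (Lh : ℝ) ^ d := by ring

/-- Bookkeeping of the induction step, (a): `(8u²)^A ≤ u^{3A}` and `K ≤ C u^{3A}` for `u ≥ 8`.
[folklore] -/
theorem weyl_step_K_le {A : ℕ} {C u K : ℝ} (hC0 : 0 ≤ C) (hu8 : 8 ≤ u)
    (hK : K ≤ C * (8 * u ^ 2) ^ A) : K ≤ C * u ^ (3 * A) := by
  have hu0 : 0 ≤ u := by linarith
  have h8A : (8 : ℝ) ^ A ≤ u ^ A := pow_le_pow_left₀ (by norm_num) hu8 A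
  have h : (8 * u ^ 2) ^ A ≤ u ^ (3 * A) := by
    rw [mul_pow, ← pow_mul]
    calc (8 : ℝ) ^ A * u ^ (2 * A) ≤ u ^ A * u ^ (2 * A) :=
          mul_le_mul_of_nonneg_right h8A (by positivity)
      _ = u ^ (3 * A) := by rw [← pow_add]; ring_nf
  exact hK.trans (mul_le_mul_of_nonneg_left h hC0)

/-- Bookkeeping of the induction step, (b): the side conditions of the linear recurrence lemma.
With `u ≥ 8`, `C ≥ 1`, `1 ≤ K ≤ C u^{3A}`, `δ₁ = 1/(2uK)`, `ε₀ ≤ C u^{3A+d}/L^d`, `1 ≤ d` and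
`L ≥ 96 C² u^{6A+d+2}`: `ε₀ ≤ δ₁/32` and `24/δ₁² ≤ L`. [folklore] -/
theorem weyl_step_sideConditions {A d : ℕ} {C u K δ₁ ε₀ L : ℝ} (hC1 : 1 ≤ C) (hu8 : 8 ≤ u)
    (hK1 : 1 ≤ K) (hKu : K ≤ C * u ^ (3 * A)) (hδ₁ : δ₁ = 1 / (2 * u * K)) (hd : 1 ≤ d)
    (hL1 : 1 ≤ L) (hε₀ : ε₀ ≤ C * u ^ (3 * A + d) / L ^ d)
    (hΘ : 96 * C ^ 2 * u ^ (6 * A + d + 2) ≤ L) :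
    ε₀ ≤ δ₁ / 32 ∧ 24 / δ₁ ^ 2 ≤ L := by
  have hu1 : 1 ≤ u := by linarith
  have hupow : ∀ {m n : ℕ}, m ≤ n → u ^ m ≤ u ^ n := fun h => pow_le_pow_right₀ hu1 h
  have hC0 : 0 < C := by linarith
  have hL0 : 0 < L := by linarith
  have hK0 : 0 < K := by linarith
  have hδ₁0 : 0 < δ₁ := by rw [hδ₁]; positivity
  have hinv : 1 / δ₁ = 2 * u * K := by rw [hδ₁]; field_simp
  have hinv' : 1 / δ₁ ≤ 2 * C * u ^ (3 * A + 1) := by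
    rw [hinv]
    calc 2 * u * K ≤ 2 * u * (C * u ^ (3 * A)) := mul_le_mul_of_nonneg_left hKu (by positivity)
      _ = 2 * C * u ^ (3 * A + 1) := by rw [pow_succ]; ring
  have hLd : L ≤ L ^ d := by
    calc L = L ^ 1 := (pow_one _).symm
      _ ≤ L ^ d := pow_le_pow_right₀ hL1 hd
  constructor
  · have h1 : ε₀ * (32 * (1 / δ₁)) ≤ 1 := by
      calc ε₀ * (32 * (1 / δ₁))
          ≤ (C * u ^ (3 * A + d) / L ^ d) * (32 * (2 * C * u ^ (3 * A + 1))) :=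
            mul_le_mul hε₀ (by linarith) (by positivity) (by positivity)
        _ = 64 * C ^ 2 * u ^ (6 * A + d + 1) / L ^ d := by
            rw [show 6 * A + d + 1 = (3 * A + d) + (3 * A + 1) by ring, pow_add]
            field_simp
            ring
        _ ≤ 64 * C ^ 2 * u ^ (6 * A + d + 1) / L :=
            div_le_div_of_nonneg_left (by positivity) hL0 hLd
        _ ≤ 1 := by
            rw [div_le_one hL0]
            refine le_trans ?_ hΘ
            have hexp : u ^ (6 * A + d + 1) ≤ u ^ (6 * A + d + 2) := hupow (by omega)
            calc 64 * C ^ 2 * u ^ (6 * A + d + 1) ≤ 96 * C ^ 2 * u ^ (6 * A + d + 1) := by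
                  apply mul_le_mul_of_nonneg_right _ (by positivity)
                  nlinarith
              _ ≤ 96 * C ^ 2 * u ^ (6 * A + d + 2) :=
                  mul_le_mul_of_nonneg_left hexp (by positivity)
    have h2 : ε₀ * (32 * (1 / δ₁)) * δ₁ ≤ 1 * δ₁ := mul_le_mul_of_nonneg_right h1 hδ₁0.le
    have h3 : ε₀ * (32 * (1 / δ₁)) * δ₁ = ε₀ * 32 := by field_simp
    rw [h3, one_mul] at h2
    linarith
  · have h1 : 24 / δ₁ ^ 2 = 24 * (1 / δ₁) ^ 2 := by field_simp
    rw [h1]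
    calc 24 * (1 / δ₁) ^ 2 ≤ 24 * (2 * C * u ^ (3 * A + 1)) ^ 2 := by
          apply mul_le_mul_of_nonneg_left _ (by norm_num)
          exact pow_le_pow_left₀ (by positivity) hinv' 2
      _ = 96 * C ^ 2 * u ^ (6 * A + 2) := by
          rw [show 6 * A + 2 = 2 * (3 * A + 1) by ring, pow_mul]
          ring
      _ ≤ 96 * C ^ 2 * u ^ (6 * A + d + 2) :=
          mul_le_mul_of_nonneg_left (hupow (by omega)) (by positivity)
      _ ≤ L := hΘ

/-- Bookkeeping of the induction step, (c): the new multiplier `q k (d+1)` and the new distance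
`48 ε₀/(δ₁² L)` are `≤ C' u^E` and `≤ C' u^E / L^{d+1}` with
`E = (6A+d+2)(d+1) + 9A + d + 2`, `C' = 192 C³ (96C²)^{d+1} · 4(d+1)`. [folklore] -/
theorem weyl_step_newConstants {A d : ℕ} {C u K δ₁ ε₀ L q k : ℝ} (hC1 : 1 ≤ C) (hu8 : 8 ≤ u)
    (hK1 : 1 ≤ K) (hKu : K ≤ C * u ^ (3 * A)) (hδ₁ : δ₁ = 1 / (2 * u * K))
    (hL0 : 0 < L) (hε₀ : ε₀ ≤ C * u ^ (3 * A + d) / L ^ d)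
    (hq : q ≤ 2 / δ₁) (hk0 : 0 ≤ k) (hk : k ≤ K) :
    q * k * (d + 1) ≤ 192 * C ^ 3 * (96 * C ^ 2) ^ (d + 1) * (4 * (d + 1)) *
        u ^ ((6 * A + d + 2) * (d + 1) + 9 * A + d + 2) ∧
      48 * ε₀ / (δ₁ ^ 2 * L) ≤ 192 * C ^ 3 * (96 * C ^ 2) ^ (d + 1) * (4 * (d + 1)) *
        u ^ ((6 * A + d + 2) * (d + 1) + 9 * A + d + 2) / L ^ (d + 1) := by
  have hu1 : 1 ≤ u := by linarith
  have hupow : ∀ {m n : ℕ}, m ≤ n → u ^ m ≤ u ^ n := fun h => pow_le_pow_right₀ hu1 h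
  have hC0 : 0 < C := by linarith
  have hK0 : 0 < K := by linarith
  have hδ₁0 : 0 < δ₁ := by rw [hδ₁]; positivity
  have hinv : 1 / δ₁ = 2 * u * K := by rw [hδ₁]; field_simp
  have hinv' : 1 / δ₁ ≤ 2 * C * u ^ (3 * A + 1) := by
    rw [hinv]
    calc 2 * u * K ≤ 2 * u * (C * u ^ (3 * A)) := mul_le_mul_of_nonneg_left hKu (by positivity)
      _ = 2 * C * u ^ (3 * A + 1) := by rw [pow_succ]; ring
  have hd0 : (0 : ℝ) ≤ d := Nat.cast_nonneg d
  have h96 : (1 : ℝ) ≤ (96 * C ^ 2) ^ (d + 1) := one_le_pow₀ (by nlinarith)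
  set C' : ℝ := 192 * C ^ 3 * (96 * C ^ 2) ^ (d + 1) * (4 * (d + 1)) with hC'
  constructor
  · have hqle : q ≤ 2 * (1 / δ₁) := by rw [← div_eq_mul_one_div]; exact hq
    calc q * k * (d + 1) ≤ (2 * (2 * C * u ^ (3 * A + 1))) * (C * u ^ (3 * A)) * (d + 1) := by
          apply mul_le_mul_of_nonneg_right _ (by positivity)
          exact mul_le_mul (hqle.trans (by linarith)) (hk.trans hKu) hk0 (by positivity)
      _ = 4 * (d + 1) * C ^ 2 * u ^ (6 * A + 1) := by
          rw [show 6 * A + 1 = (3 * A + 1) + 3 * A by ring, pow_add]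
          ring
      _ ≤ C' * u ^ ((6 * A + d + 2) * (d + 1) + 9 * A + d + 2) := by
          apply mul_le_mul _ (hupow (by nlinarith)) (by positivity) (by positivity)
          rw [hC']
          have h1 : (1 : ℝ) ≤ 192 * C := by linarith
          have h0 : (0 : ℝ) ≤ 4 * (d + 1) * C ^ 2 := by positivity
          calc 4 * ((d : ℝ) + 1) * C ^ 2 = 1 * (4 * (d + 1) * C ^ 2) * 1 := by ring
            _ ≤ (192 * C) * (4 * (d + 1) * C ^ 2) * (96 * C ^ 2) ^ (d + 1) :=
                mul_le_mul (mul_le_mul_of_nonneg_right h1 h0) h96 (by positivity)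
                  (by positivity)
            _ = 192 * C ^ 3 * (96 * C ^ 2) ^ (d + 1) * (4 * (d + 1)) := by ring
  · have h1 : 48 * ε₀ / (δ₁ ^ 2 * L) = 48 * ε₀ * (1 / δ₁) ^ 2 / L := by
      field_simp
    rw [h1]
    calc 48 * ε₀ * (1 / δ₁) ^ 2 / L
        ≤ 48 * (C * u ^ (3 * A + d) / L ^ d) * (2 * C * u ^ (3 * A + 1)) ^ 2 / L := by
          apply div_le_div_of_nonneg_right _ hL0.le
          apply mul_le_mul (mul_le_mul_of_nonneg_left hε₀ (by norm_num))
            (pow_le_pow_left₀ (by positivity) hinv' 2) (by positivity) (by positivity)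
      _ = 192 * C ^ 3 * u ^ (9 * A + d + 2) / L ^ (d + 1) := by
          rw [show 9 * A + d + 2 = (3 * A + d) + 2 * (3 * A + 1) by ring, pow_add, pow_mul,
            pow_succ]
          field_simp
          ring
      _ ≤ C' * u ^ ((6 * A + d + 2) * (d + 1) + 9 * A + d + 2) / L ^ (d + 1) := by
          apply div_le_div_of_nonneg_right _ (by positivity)
          apply mul_le_mul _ (hupow (by omega)) (by positivity) (by positivity)
          rw [hC']
          have h3 : (1 : ℝ) ≤ 4 * (d + 1) := by linarith
          calc 192 * C ^ 3 = 192 * C ^ 3 * 1 * 1 := by ring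
            _ ≤ 192 * C ^ 3 * (96 * C ^ 2) ^ (d + 1) * (4 * (d + 1)) := by
                gcongr

/-- Bookkeeping of the induction step, (d): the small-`L` case. If `L < Θ = 96C²u^{6A+d+2}` then
`1/2 ≤ C' u^E / L^{d+1}` and `1 ≤ C' u^E`. [folklore] -/
theorem weyl_step_small {A d : ℕ} {C u L : ℝ} (hC1 : 1 ≤ C) (hu8 : 8 ≤ u) (hL0 : 0 < L)
    (hsmall : L < 96 * C ^ 2 * u ^ (6 * A + d + 2)) :
    (1 : ℝ) ≤ 192 * C ^ 3 * (96 * C ^ 2) ^ (d + 1) * (4 * (d + 1)) *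
        u ^ ((6 * A + d + 2) * (d + 1) + 9 * A + d + 2) ∧
      1 / 2 ≤ 192 * C ^ 3 * (96 * C ^ 2) ^ (d + 1) * (4 * (d + 1)) *
        u ^ ((6 * A + d + 2) * (d + 1) + 9 * A + d + 2) / L ^ (d + 1) := by
  have hu1 : 1 ≤ u := by linarith
  have hupow : ∀ {m n : ℕ}, m ≤ n → u ^ m ≤ u ^ n := fun h => pow_le_pow_right₀ hu1 h
  have hd0 : (0 : ℝ) ≤ d := Nat.cast_nonneg d
  have hC3 : (1 : ℝ) ≤ C ^ 3 := one_le_pow₀ hC1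
  have h96 : (1 : ℝ) ≤ (96 * C ^ 2) ^ (d + 1) := one_le_pow₀ (by nlinarith)
  have hd1 : (1 : ℝ) ≤ 4 * (d + 1) := by linarith
  set C' : ℝ := 192 * C ^ 3 * (96 * C ^ 2) ^ (d + 1) * (4 * (d + 1)) with hC'
  set E : ℕ := (6 * A + d + 2) * (d + 1) + 9 * A + d + 2 with hE
  have hC'1 : 1 ≤ C' := by
    rw [hC']
    calc (1 : ℝ) ≤ 192 * 1 * 1 * 1 := by norm_num
      _ ≤ 192 * C ^ 3 * (96 * C ^ 2) ^ (d + 1) * (4 * (d + 1)) := by gcongr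
  have huE : 1 ≤ u ^ E := one_le_pow₀ hu1
  constructor
  · nlinarith
  · rw [le_div_iff₀ (by positivity)]
    have h1 : L ^ (d + 1) ≤ (96 * C ^ 2 * u ^ (6 * A + d + 2)) ^ (d + 1) :=
      pow_le_pow_left₀ hL0.le hsmall.le (d + 1)
    have h2 : (96 * C ^ 2 * u ^ (6 * A + d + 2)) ^ (d + 1) =
        (96 * C ^ 2) ^ (d + 1) * u ^ ((6 * A + d + 2) * (d + 1)) := by
      rw [mul_pow, ← pow_mul]
    have h4 : u ^ ((6 * A + d + 2) * (d + 1)) ≤ u ^ E := hupow (by rw [hE]; omega)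
    have h5 : (96 * C ^ 2) ^ (d + 1) ≤ 2 * C' := by
      rw [hC']
      calc (96 * C ^ 2) ^ (d + 1) = 1 * (96 * C ^ 2) ^ (d + 1) * 1 := by ring
        _ ≤ (2 * 192 * C ^ 3) * (96 * C ^ 2) ^ (d + 1) * (4 * (d + 1)) := by
            gcongr
            · linarith
        _ = 2 * (192 * C ^ 3 * (96 * C ^ 2) ^ (d + 1) * (4 * (d + 1))) := by ring
    calc 1 / 2 * L ^ (d + 1) ≤ 1 / 2 * ((96 * C ^ 2) ^ (d + 1) * u ^ ((6 * A + d + 2) * (d + 1))) := by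
          rw [← h2]
          exact mul_le_mul_of_nonneg_left h1 (by norm_num)
      _ ≤ 1 / 2 * ((2 * C') * u ^ E) := by
          apply mul_le_mul_of_nonneg_left _ (by norm_num)
          exact mul_le_mul h5 h4 (by positivity) (by positivity)
      _ = C' * u ^ E := by ring

/-- **The induction step of Weyl's estimate**: the degree-`d` statement with constants `(A, C)`
implies the degree-`(d+1)` statement with constants
`(E, C') = ((6A+d+2)(d+1) + 9A + d + 2, 192 C³ (96C²)^{d+1} · 4(d+1))`.
[cite: GreenTao2012Nilmanifolds, Lemma 4.4 (proof)] -/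
theorem weyl_topCoeff_step {d : ℕ} (hd : 1 ≤ d) {A : ℕ} {C : ℝ} (hC1 : 1 ≤ C)
    (hIH : ∀ (δ : ℝ) (a : ℤ) (L : ℕ) (p : ℝ[X]), 0 < δ → δ ≤ 1 → p.natDegree ≤ d → 1 ≤ L →
        δ * L ≤ ‖∑ n ∈ Finset.Ioc a (a + L), VdC.e (p.eval (n : ℝ))‖ →
        ∃ k : ℕ, 1 ≤ k ∧ (k : ℝ) ≤ C * (8 / δ ^ 2) ^ A ∧
          distInt (k * p.coeff d) ≤ C * (8 / δ ^ 2) ^ A / (L : ℝ) ^ d)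
    {δ : ℝ} (hδ : 0 < δ) (hδ1 : δ ≤ 1) (a : ℤ) {L : ℕ} (hL : 1 ≤ L) {p : ℝ[X]}
    (hp : p.natDegree ≤ d + 1)
    (hS : δ * L ≤ ‖∑ n ∈ Finset.Ioc a (a + L), VdC.e (p.eval (n : ℝ))‖) :
    ∃ k : ℕ, 1 ≤ k ∧
      (k : ℝ) ≤ 192 * C ^ 3 * (96 * C ^ 2) ^ (d + 1) * (4 * (d + 1)) *
          (8 / δ ^ 2) ^ ((6 * A + d + 2) * (d + 1) + 9 * A + d + 2) ∧
      distInt (k * p.coeff (d + 1)) ≤ 192 * C ^ 3 * (96 * C ^ 2) ^ (d + 1) * (4 * (d + 1)) *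
          (8 / δ ^ 2) ^ ((6 * A + d + 2) * (d + 1) + 9 * A + d + 2) / (L : ℝ) ^ (d + 1) := by
  classical
  have hC0 : 0 < C := by linarith
  have hδ2 : 0 < δ ^ 2 := by positivity
  set u : ℝ := 8 / δ ^ 2 with hu
  have hu8 : 8 ≤ u := by
    rw [hu, le_div_iff₀ hδ2]
    nlinarith
  have hLpos : (0 : ℝ) < L := by exact_mod_cast hL
  rcases lt_or_ge (L : ℝ) (96 * C ^ 2 * u ^ (6 * A + d + 2)) with hsmall | hlarge
  · obtain ⟨h1, h2⟩ := weyl_step_small (A := A) (d := d) hC1 hu8 hLpos hsmall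
    exact ⟨1, le_rfl, by rw [Nat.cast_one]; exact h1,
      by rw [Nat.cast_one, one_mul]; exact (distInt_le_half _).trans h2⟩
  -- Step 1: van der Corput
  have hLu : u ≤ L := by
    refine le_trans ?_ hlarge
    have hu1 : 1 ≤ u := by linarith
    have h1 : u ≤ u ^ (6 * A + d + 2) := by
      calc u = u ^ 1 := (pow_one u).symm
        _ ≤ u ^ (6 * A + d + 2) := pow_le_pow_right₀ hu1 (by omega)
    have h2 : (1 : ℝ) ≤ 96 * C ^ 2 := by nlinarith
    calc u ≤ u ^ (6 * A + d + 2) := h1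
      _ = 1 * u ^ (6 * A + d + 2) := (one_mul _).symm
      _ ≤ 96 * C ^ 2 * u ^ (6 * A + d + 2) := mul_le_mul_of_nonneg_right h2 (by positivity)
  have hvdc := card_goodShifts_ge_of_norm_sum_e_ge (fun x : ℝ => p.eval x) (a := a) (b := a + L)
    hδ hδ1 (by rw [show a + (L : ℤ) - a = L by ring]; push_cast; rw [hu] at hLu; exact hLu)
    (by rw [show a + (L : ℤ) - a = L by ring]; push_cast; exact hS)
  rw [show a + (L : ℤ) - a = L by ring] at hvdc
  push_cast at hvdc
  set G : Finset ℤ := (Finset.Ico (1 : ℤ) L).filter fun h =>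
    δ ^ 2 * (L : ℝ) / 8 ≤ ‖∑ n ∈ Finset.Ioc a (a + L - h),
      VdC.e (p.eval ((n : ℝ) + (h : ℝ)) - p.eval (n : ℝ))‖ with hG
  have hGcard : δ ^ 2 * L / 16 ≤ #G := hvdc
  -- Step 2: the induction hypothesis for each good shift
  set c : ℝ := p.coeff (d + 1) with hc
  set Kr : ℝ := C * (8 * u ^ 2) ^ A with hKr
  set K : ℕ := ⌊Kr⌋₊ with hK
  have hKr1 : 1 ≤ Kr := by
    rw [hKr]
    calc (1 : ℝ) ≤ C := hC1
      _ = C * 1 := (mul_one C).symm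
      _ ≤ C * (8 * u ^ 2) ^ A := mul_le_mul_of_nonneg_left (one_le_pow₀ (by nlinarith)) hC0.le
  have hKle : (K : ℝ) ≤ Kr := Nat.floor_le (by linarith)
  have hK1 : 1 ≤ K := by
    rw [hK]
    exact Nat.le_floor (by rw [Nat.cast_one]; exact hKr1)
  have hK1R : (1 : ℝ) ≤ K := by exact_mod_cast hK1
  set ε₀ : ℝ := C * (8 * u ^ 2) ^ A * u ^ d / (L : ℝ) ^ d with hε₀
  have hε₀0 : 0 < ε₀ := by positivity
  have hIH' : ∀ h ∈ G, ∃ k : ℕ, 1 ≤ k ∧ k ≤ K ∧ distInt (h * (k * ((d + 1) * c))) ≤ ε₀ := by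
    intro h hh
    rw [hG, Finset.mem_filter, Finset.mem_Ico] at hh
    obtain ⟨⟨hh1, hhL⟩, hgood⟩ := hh
    obtain ⟨k, hk1, hkK, hkdist⟩ := weyl_step_shift hC0 hIH hδ hδ1 a hp hh1 hhL hgood
    refine ⟨k, hk1, ?_, hkdist⟩
    rw [hK]
    exact Nat.le_floor hkK
  -- Step 3: pigeonhole the denominators
  choose! kf hkf using hIH'
  obtain ⟨k, hk1, hkK, hfib⟩ :=
    exists_popular_label G kf hK1 (fun h hh => ⟨(hkf h hh).1, (hkf h hh).2.1⟩)
  set F : Finset ℤ := G.filter fun h => kf h = k with hF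
  set α' : ℝ := k * ((d + 1) * c) with hα'
  have hFgood : ∀ h ∈ F, distInt (h * α') ≤ ε₀ := by
    intro h hh
    rw [hF, Finset.mem_filter] at hh
    have := (hkf h hh.1).2.2
    rw [hh.2] at this
    exact this
  -- Step 4: the linear recurrence lemma for `α'` on `[1, L]`
  set δ₁ : ℝ := 1 / (2 * u * K) with hδ₁
  have hδ₁0 : 0 < δ₁ := by positivity
  have hδ₁1 : δ₁ ≤ 1 := by
    rw [hδ₁, div_le_one (by positivity)]
    nlinarith
  have hδ₁eq : δ₁ = δ ^ 2 / (16 * K) := by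
    rw [hδ₁, hu]
    field_simp
    ring
  have hcount : δ₁ * L ≤ #((Finset.Icc 1 L).filter fun n : ℕ => |n * α' - round (n * α')| ≤ ε₀) := by
    have hKpos : (0 : ℝ) < K := by linarith
    have h1 : δ₁ * L ≤ #F := by
      rw [hδ₁eq]
      have : δ ^ 2 / (16 * K) * L = (δ ^ 2 * L / 16) / K := by
        field_simp
      rw [this]
      exact (div_le_div_of_nonneg_right hGcard hKpos.le).trans hfib
    have h2 : #F ≤ #((Finset.Icc 1 L).filter fun n : ℕ => |n * α' - round (n * α')| ≤ ε₀) := by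
      refine Finset.card_le_card_of_injOn (fun h : ℤ => h.toNat) ?_ ?_
      · intro h hh
        have hhF := hh
        rw [Finset.mem_coe, hF, Finset.mem_filter, hG, Finset.mem_filter, Finset.mem_Ico] at hh
        obtain ⟨⟨⟨hh1, hhL⟩, _⟩, _⟩ := hh
        rw [Finset.mem_coe, Finset.mem_filter, Finset.mem_Icc]
        dsimp only
        have htoNat : ((h.toNat : ℕ) : ℤ) = h := Int.toNat_of_nonneg (by omega)
        refine ⟨⟨by omega, by omega⟩, ?_⟩
        have hcast : ((h.toNat : ℕ) : ℝ) = (h : ℝ) := by exact_mod_cast htoNat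
        rw [hcast]
        exact hFgood h hhF
      · intro h hh h' hh' heq
        rw [Finset.mem_coe, hF, Finset.mem_filter, hG, Finset.mem_filter, Finset.mem_Ico] at hh hh'
        have h1 : ((h.toNat : ℕ) : ℤ) = h := Int.toNat_of_nonneg (by omega)
        have h2 : ((h'.toNat : ℕ) : ℤ) = h' := Int.toNat_of_nonneg (by omega)
        dsimp only at heq
        rw [← h1, ← h2, heq]
    calc δ₁ * L ≤ #F := h1
      _ ≤ _ := by exact_mod_cast h2
  have hKu : (K : ℝ) ≤ C * u ^ (3 * A) := weyl_step_K_le hC0.le hu8 hKle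
  have h8u2 : (8 * u ^ 2) ^ A ≤ u ^ (3 * A) := by
    have := weyl_step_K_le (K := (8 * u ^ 2) ^ A) (C := 1) (A := A) zero_le_one hu8 (by rw [one_mul])
    rwa [one_mul] at this
  have hε₀u : ε₀ ≤ C * u ^ (3 * A + d) / (L : ℝ) ^ d := by
    rw [hε₀]
    apply div_le_div_of_nonneg_right _ (by positivity)
    calc C * (8 * u ^ 2) ^ A * u ^ d ≤ C * u ^ (3 * A) * u ^ d := by
          apply mul_le_mul_of_nonneg_right _ (by positivity)
          exact mul_le_mul_of_nonneg_left h8u2 hC0.le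
      _ = C * u ^ (3 * A + d) := by rw [pow_add]; ring
  have hL1R : (1 : ℝ) ≤ L := by exact_mod_cast hL
  obtain ⟨hcond1, hcond2⟩ := weyl_step_sideConditions hC1 hu8 hK1R hKu hδ₁ hd hL1R hε₀u hlarge
  obtain ⟨q, hq1, hqδ, hqdist⟩ :=
    exists_denominator_of_recurrent_linear hδ₁0 hδ₁1 hε₀0 hcond1 hcond2 hcount
  -- Step 5: the new multiplier `q k (d+1)`
  obtain ⟨hmult, hdist⟩ := weyl_step_newConstants (q := (q : ℝ)) (k := (k : ℝ)) hC1 hu8 hK1R hKu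
    hδ₁ hLpos hε₀u hqδ (Nat.cast_nonneg k) (by exact_mod_cast hkK)
  refine ⟨q * k * (d + 1), Nat.mul_pos (Nat.mul_pos hq1 hk1) (Nat.succ_pos d), ?_, ?_⟩
  · push_cast
    exact hmult
  · have e : ((q * k * (d + 1) : ℕ) : ℝ) * c = q * α' := by
      rw [hα']
      push_cast
      ring
    rw [e]
    exact le_trans hqdist hdist

/-- **Green–Tao 2012, Lemma 4.4 (Weyl's exponential sum estimate for the top coefficient),
explicit-existential form.** For every `d ≥ 1` there are `A ∈ ℕ`, `C ≥ 1` such that: if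
`p ∈ ℝ[X]` has degree `≤ d`, `0 < δ ≤ 1`, `L ≥ 1`, and `‖∑_{a<n≤a+L} e(p(n))‖ ≥ δ L`, then some
`1 ≤ k ≤ C (8/δ²)^A` has `‖k p_d‖_{ℝ/ℤ} ≤ C (8/δ²)^A / L^d` (`p_d` the coefficient of `X^d`,
`‖·‖_{ℝ/ℤ} = Literature.NumberTheory.Sieve.Vinogradov.distInt`). Proof by induction on `d`
(`weyl_topCoeff_step`): van der Corput (`card_goodShifts_ge_of_norm_sum_e_ge`), the induction
hypothesis for the differences `Δ_h p`, pigeonholing the denominators, and the linear recurrence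
lemma (`exists_denominator_of_recurrent_linear`); the base case is the geometric series.
[cite: GreenTao2012Nilmanifolds, Lemma 4.4] [cite: Teravainen2024, §5.4 (Lemma 5.6, "standard
estimates for Weyl sums")] -/
theorem weyl_topCoeff (d : ℕ) (hd : 1 ≤ d) :
    ∃ (A : ℕ) (C : ℝ), 1 ≤ C ∧
      ∀ (δ : ℝ) (a : ℤ) (L : ℕ) (p : ℝ[X]), 0 < δ → δ ≤ 1 → p.natDegree ≤ d → 1 ≤ L →
        δ * L ≤ ‖∑ n ∈ Finset.Ioc a (a + L), VdC.e (p.eval (n : ℝ))‖ →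
        ∃ k : ℕ, 1 ≤ k ∧ (k : ℝ) ≤ C * (8 / δ ^ 2) ^ A ∧
          distInt (k * p.coeff d) ≤ C * (8 / δ ^ 2) ^ A / (L : ℝ) ^ d := by
  induction d, hd using Nat.le_induction with
  | base =>
    refine ⟨1, 1, le_rfl, fun δ a L p hδ hδ1 hp hL hS => ⟨1, le_rfl, ?_, ?_⟩⟩
    · have hδ2 : 0 < δ ^ 2 := by positivity
      rw [pow_one, one_mul, Nat.cast_one, le_div_iff₀ hδ2]
      nlinarith
    · have h := distInt_coeff_one_le_of_norm_sum_e_ge hp hδ a hL hS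
      have hLpos : (0 : ℝ) < L := by exact_mod_cast hL
      rw [Nat.cast_one, one_mul, pow_one, pow_one, one_mul]
      refine h.trans ?_
      rw [div_le_div_iff₀ (by positivity) hLpos]
      have e : 8 / δ ^ 2 * (2 * δ * L) = 16 / δ * L := by
        field_simp
        ring
      rw [e, one_mul]
      have h16 : (1 : ℝ) ≤ 16 / δ := by
        rw [le_div_iff₀ hδ]
        linarith
      nlinarith
  | succ d hd IH =>
    obtain ⟨A, C, hC1, hIH⟩ := IH
    refine ⟨(6 * A + d + 2) * (d + 1) + 9 * A + d + 2,
      192 * C ^ 3 * (96 * C ^ 2) ^ (d + 1) * (4 * (d + 1)), ?_, fun δ a L p hδ hδ1 hp hL hS =>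
        weyl_topCoeff_step hd hC1 hIH hδ hδ1 a hL hp hS⟩
    have hd0 : (0 : ℝ) ≤ d := Nat.cast_nonneg d
    have hC3 : (1 : ℝ) ≤ C ^ 3 := one_le_pow₀ hC1
    have h96 : (1 : ℝ) ≤ (96 * C ^ 2) ^ (d + 1) := one_le_pow₀ (by nlinarith)
    have hd1 : (1 : ℝ) ≤ 4 * (d + 1) := by linarith
    calc (1 : ℝ) ≤ 192 * 1 * 1 * 1 := by norm_num
      _ ≤ 192 * C ^ 3 * (96 * C ^ 2) ^ (d + 1) * (4 * (d + 1)) := by gcongr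

end Teravainen2024

end Literature.NumberTheory.Sieve
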